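import Literature.NumberTheory.LFunctions.Zhang2022.RepairIntakeBfam

/-!
# Zhang (2022), programme F-S3 §E (cell landau-siegel, barrier extension, stub S-E-bf2): the B-fam designs OF RECORD
# as TERMS of the intake's design types (`Repair.BfamDesign` of `RepairIntakeBfam`, INTAKE-3 p474295), with their
# memberships `KBfam` PROVED and their verdicts `VBfam` evaluated — C4 of INTAKE-3 BY TERM, row-shape by row-shape

H. Iwaniec, *Conversations on the exceptional character*, LNM 1891 (2006) §7 [IwaniecConversations2006];
E. Kowalski, P. Michel, J. VanderKam, *Non-vanishing of high derivatives of automorphic L-functions at the center of the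
critical strip*, J. reine angew. Math. 526 (2000) 1–34 [KowalskiMichelVanderKam2000] (held: paper:doi-10-1515-crll-2000-074;
Props 4.1/5.1, Thm 6.1 = the (I) deciders' source); programme context: Y. Zhang, *Discrete mean
estimates and the Landau–Siegel zero*, arXiv:2211.02515v1 [Zhang2022LandauSiegel] — an unrefereed manuscript under
adjudication. **WHAT THIS IS NOT: not a claim about Theorems 1–2 of arXiv:2211.02515, about Landau–Siegel zeros,
about a repaired `Margin232`, about Parity, and not a statement that any design «closes»: this file is PURE GLUE
(D-0064, one module) — it writes the designs of B-fam's design map as terms of the intake's constructors, proves that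
each lies in the class `K_fam` (`KBfam`, NO analytic hypothesis), and reads off the verdict the intake attaches to it
(`VBfam`, by `familyBfam_decided` — flags (I) DECIDED BY THEOREM, (II-a) CONDITIONAL on three displayed printed
inputs, (II-b) GIVEN B-AH(fam) with 0 rows evaluated). No new `Prop` fact, no number of the cell's numerics enters a
statement (the exact rationals below are KERNEL identities of the typed functionals `OnePieceMollifierCeiling.propIS`,
`KMV2000.ratio`, `KMV2000.envelope`). The programme SEARCHES and TYPES; no claim about Landau–Siegel zeros,
Theorems 1–2 of arXiv:2211.02515 or a repaired Margin232 until a kernel theorem says so.**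

**Certificate and intake of record.** Word = director-frontier g6 2026-08-26T20:55:00Z «KILL(B-fam) ISSUED», KILLED
OF RECORD 21:15:26Z; text HOME/B-fam/KILL-draft.md v2.2.2 sha16 06cd652c2917c102 (§1 lines 4–6 sha16 817b59c08b1564d9,
§2 lines 7–14 sha16 b6c520d7224008a5) — quoted VERBATIM in `RepairIntakeBfam` (C1; second read of record by this
seat, INBOX 2026-08-26T23:55:49Z: 9/9 lines verbatim; REF-E INTAKE-3 PASS on v1.0.3, ls-barrier-ref g2
2026-08-27T00:10:14Z); intake versions `RepairIntakeBfam.lean` p474295 → v1.0.1 p475347 → v1.0.2 p476039 ((iii) range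
`θ < 1/6`) → v1.0.3 p476369 (REF-B3 D1: (iv) displays BOTH expanded-length ranges `α + Δ ≤ 1 ∧ 2α + Δ ≤ 1`), all
→ **v1.0.4 p477160 = BYTES OF RECORD** (REF-B3 D4 form (a): (iii) range `0 < θ < 1/2` with the (iii)-GIVEN sentence;
statements FROZEN, ls-barrier-plan g1 2026-08-27T00:14:01Z), all ACCEPTED — the (iv) membership proof below takes the
FIRST-moment range `2α + Δ ≤ 1` and closes the `InRange` conjunction leaf by leaf (it elaborates against the v1.0.2 and
the v1.0.3+ texts alike); the (iii) members use `θ ∈ (0, 1/2)` and SAY which GIVEN sub-range they sit in (`θ < 1/6`: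
BPZ Props 2.1–2.3 proved, p457180; `1/6 ≤ θ < 1/2`: the band, extension of Props 2.2/2.3 presupposed). Design map of
record: B-fam/DESIGN-MAP-fam.md v1.7.3 (writer
ls-Bfam-plan), design files B-fam/designs/fam-C0-G0.json d1a4787f8cc08499, fam-C0-cal.json 672905a829f56c2d,
fam-C1-laws-B.json; member catalogue = ls-Bfam-typer-2 g2 INBOX 2026-08-26T21:34:09Z (2) and the constructor field
types INBOX 23:18:18Z. Assignment: barrier/ASSIGNMENTS.md S-E-bf2 (ls-barrier-plan g1 23:01:16Z / 23:32:43Z; owner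
ls-Bfam-typer-1 g2, backup ls-Blen-typer-2 g3 — this file).

## The members, row-shape by row-shape (DESIGN-MAP-fam v1.7.3 §1–§6)

Normalisations (intake table, KILL-draft §2 common box): `Δ` = logarithmic mollifier length in KMV's normalisation
(`𝕄 = q̂^Δ`, `q̂² ≍ |family|`; «(expanded length)² ≤ |family|» reads `Δ ≤ 1`); a KMV profile `P` has
`P(0) = P′(0) = 0` (`KMV2000.Admissible`); an Iwaniec–Sarnak/H¹ profile `p` with `p(0) = 0` is entered through its
derivative `q = p′` (`= P″` in KMV's normalisation; `DiagDesign.ac`). The pairing identity of the map (FC1: «IS-onepiece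
= 2·KMV») is the kernel identity `propIS Δ (const) = Δ/(1+Δ) = 2·KMV2000.envelope Δ` (`propIS_const`,
`KMV2000.ratio_one_X_sq`), so `p(t) = t ↔ P = x²`.

| design id(s) of record | status / §2 stratum | term (this file) | membership | verdict / value of record |
|---|---|---|---|---|
| fam-C0-IS1p-lin-D1, -D1o2 (fam-C0-cal) | (I) K_fam^diag, level-individual | `memISlin Δ = .diag (.ac .levelIndividual Δ (fun _ => 1))`, `Δ = 1, ½` | `kbfam_ISlin` (0 < Δ ≤ 1) | `vbfam_ISlin`; values `propIS 1 1 = ½`, `propIS ½ 1 = ⅓` (even scale) = the map's «expected exact 1/2, 1/3» (`isLin_values`) |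
| fam-C0-KMV-Q1-x2-D1 (fam-C0-cal) | (I), KMV route `P = x²` AT `Δ = 1` | `memKMVx2one = .diag (.ac .levelIndividual 1 (fun _ => 2))` (`q = P″ = 2`; the `.poly` row is `Δ < 1` by the intake) | `kbfam_KMVx2one` | `propIS 1 2 = ½` even = `KMV2000.ratio 1 x² 1 = ¼` all (`kmvx2_values`; FC1) |
| G0-IS1p-free8-DΔ, Δ = k/20, k = 1…19 (G0.json) and every free-profile row at `Δ < 1` (fam-C0-free14-D3o4, …) | (I), free KMV profile | `memFreePoly A Δ P = .diag (.poly A Δ P)` | `kbfam_freePoly` (0 < Δ < 1, `Admissible P`); grid `kbfam_G0_grid` (k ≤ 19 — the twentieth point `Δ = 1` is NOT a `.poly` member (KMV's printed range `Δ < 1`): it is the `.ac` row below, e.g. `kbfam_ISlin` at `Δ = 1` / `kbfam_freeAC`); span lemma `KMV2000.admissible_span` (every `Σ cᵢ x^{i+2}` is admissible) | `vbfam_freePoly`: `ratio Δ P 1 ≤ envelope Δ ∧ < ¼`; `ratio Δ x² 1 = envelope Δ` |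
| G0-IS1p-free8-D1 (k = 20), fam-C0-IS1p-free14-D1, fam-C0-KMV-Q1-free12-D1 | (I) at the endpoint `Δ = 1` | `memFreeAC A Δ R = .diag (.ac A Δ (fun x => R.eval x))` (`q` a polynomial) | `kbfam_freeAC` (0 < Δ ≤ 1, any `R : ℝ[X]`) | `vbfam_freeAC`: `propIS Δ q ≤ Δ/(1+Δ) ∧ ≤ ½` |
| fam-C1-weightK, fam-C1-spectral (fam-C1-laws-B.json; law `Δ/(1+Δ)`) | (I), aspect tags `.weightAverage` / `.maassSpectral` | `memFreePoly .weightAverage Δ P`, `memFreePoly .maassSpectral Δ P` | `kbfam_C1_weightK`, `kbfam_C1_spectral` (0 < Δ < 1, `Admissible P`) | same theorem (the tag is bookkeeping) |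
| G0-IS1p-free8-DΔ-COND for Δ ∈ {21o20, 11o10, 5o4, 3o2, 2}, fam-C0-IS1p-free8-D3o2-cond and -D2-cond | (II-a) (i) C0-Δ>1 | `memCond Δ P = .beyond ⟨.levelIndividual, Δ, P⟩` | `kbfam_cond` (1 < Δ, `Admissible P`); grid `kbfam_cond_grid` (the five Δ, `P = x²`) | `vbfam_cond` (CONDITIONAL: `¼ < envelope Δ ∧ ∀ k ≥ 2 even, ForcedHalfTotal k`); diagonal-continued targets `2·envelope Δ = 21/41, 11/21, 5/9, 3/5, 2/3` (`cond_targets`, = the map's «IF the off-diagonal contributed no main term») |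
| fam-C2b split (DESIGN-MAP §4): C2b-long | (II-a) restricted average, mollifier beyond range | `.beyond ⟨.restrictedLong, Δ, P⟩` | `kbfam_C2bLong` (1 < Δ) | `vbfam` by `familyBfam_decided` |
| (η) aspect twins, amplified-long (0 design rows; statement level) | (II-a) | `.beyond ⟨.aspectTwin, Δ, P⟩`, `.beyond ⟨.amplifiedLong, Δ, P⟩` | `kbfam_aspectTwin`, `kbfam_amplifiedLong` | idem |
| C2b-T (restricted compatible average IN range; 0 rows evaluated) | (II-b) (ii) | `memC2bT Δ P p₁ p₂ = .narrow ⟨.restricted Δ P, p₁, p₂⟩` | `kbfam_C2bT` (0 < Δ ≤ 1, `Admissible P`; ANY unevaluated `(p₁,p₂)`) | `vbfam_C2bT`: `BAHfam d → ¬ d.Certifies` |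
| C2b′ BPZ-type product designs at compatible prime level (0 rows evaluated) | (II-b) (iii) | `memBPZ q D θ p₁ p₂ = .narrow ⟨.bpz q D θ, p₁, p₂⟩`; literal `memBPZ 11 3 (1/8)` (sub-range `θ < 1/6`: BPZ Props 2.1–2.3 PROVED; GIVEN = order-0 evaluation + B-AH(fam)) and `memBPZ 11 3 (1/3)` (BAND `1/6 ≤ θ < 1/2`: GIVEN additionally the extension of Props 2.2/2.3 beyond `D⁸X⁶ ≪ q^{1−ε}`) | `kbfam_bpz` (`q` prime, `1 < D`, `D ∣ q+1`, `0 < θ < 1/2` = the class of record v1.0.4), `kbfam_bpz_11_3`, `kbfam_bpz_11_3_band` | idem |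
| C3′ amplified measures: IIb-Q10 / IIb-T1 cells IN range (EVIDENCE rows; 0 design rows evaluated) | (II-b) (iv) | `memAmp S α Δ P p₁ p₂ = .narrow ⟨.amplified S α Δ P, p₁, p₂⟩`; literal `memAmp {2,3} (1/4) (1/2) x²`, `memAmp {2,3,5} (1/10) (13/20) x²` | `kbfam_amp` (`S` primes, `0 ≤ α`, `0 < Δ`, FIRST-moment range `2α + Δ ≤ 1` ⇒ second-moment `α + Δ ≤ 1`, `Admissible P`), `kbfam_amp_23`, `kbfam_amp_235` | idem |

**Declared NON-members (no term, said so; KILL-draft §2 / intake narrowings):** G0-KMV-Qy (KMV derivative vectors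
`Q = y^k`, `k ≥ 1`): CALIBRATION ONLY (F6(ii); the intake's verdict is the value floor at `Q = 1`); fam-C2a-unres at
`Δ > 1`: the UNRESTRICTED level average is an incompatible class («no (decided: not a compatible class)»; the tag
`.levelAverageUnrestricted` exists only inside (I), `Δ < 1` — entered there by `kbfam_freePoly` with that tag);
fam-C1-primepower (`Ω < ½`, BF17/18) and fam-C1-weight-indiv (`Δ < ¼`, BF21 Thm 8.7): carried BY CITATION (intake
narrowing (n1)), no constructor; IIb-Q10/IIb-T1 cells OUT of the first-moment range (`2a + Δ > 1`, flagged «N» in the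
map): not (iv)-members (context rows). Readings declared: the free-profile rows enter as ROW-SHAPES (every admissible
profile at the row's `Δ`), not as the optimiser's coefficient vector (the optimum IS a member: `KMV2000.admissible_span`);
the (II-b) coordinates `(p₁, p₂)` stay UNEVALUATED variables (0 rows evaluated at the word; a filed evaluation fixes
them and upgrades the row, intake docstring (n3)).
[cite: KowalskiMichelVanderKam2000, Props 4.1/5.1, Thm 6.1, §7 p. 21] [cite: IwaniecConversations2006, §7 (7.5)–(7.7), p. 97]
«The programme SEARCHES and TYPES; no claim about Landau–Siegel zeros, Theorems 1–2 of arXiv:2211.02515 or a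
repaired Margin232 until a kernel theorem says so.»
-/

noncomputable section

namespace Literature.NumberTheory.LFunctions

/-! ### Part 0 — admissible KMV profiles form a linear span containing every `x^n`, `n ≥ 2` -/

namespace KMV2000

open Polynomial

/-- `x^n` is an admissible KMV profile for every `n ≥ 2` (`P(0) = P′(0) = 0`).
[cite: KowalskiMichelVanderKam2000, Theorem 6.1 (admissibility P(0) = P′(0) = 0)] -/
theorem admissible_X_pow {n : ℕ} (hn : 2 ≤ n) : Admissible (X ^ n : ℝ[X]) := by
  have h0 : n ≠ 0 := by omega
  have h1 : n - 1 ≠ 0 := by omega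
  constructor
  · simp [h0]
  · simp [derivative_X_pow, h1]

/-- Admissible profiles are closed under addition. [cite: KowalskiMichelVanderKam2000, Theorem 6.1] -/
theorem Admissible.add {P Q : ℝ[X]} (hP : Admissible P) (hQ : Admissible Q) : Admissible (P + Q) := by
  refine ⟨?_, ?_⟩
  · simp [hP.1, hQ.1]
  · simp [hP.2, hQ.2]

/-- Admissible profiles are closed under scalars. [cite: KowalskiMichelVanderKam2000, Theorem 6.1] -/
theorem Admissible.smul (c : ℝ) {P : ℝ[X]} (hP : Admissible P) : Admissible (C c * P) := by
  refine ⟨?_, ?_⟩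
  · simp [hP.1]
  · simp [hP.2]

/-- The zero profile is admissible (degenerate member; its proportion is `0`).
[cite: KowalskiMichelVanderKam2000, Theorem 6.1] -/
theorem admissible_zero : Admissible (0 : ℝ[X]) := by
  constructor <;> simp

/-- **Every free-profile optimiser of the design map is admissible**: any `ℝ`-combination `Σ_{i<m} cᵢ·x^{i+2}`
(the «free profile deg ≤ 8 / 12 / 14» rows optimise over exactly this span) satisfies `P(0) = P′(0) = 0`.
[cite: KowalskiMichelVanderKam2000, Theorem 6.1, §7 p. 21] -/
theorem admissible_span (m : ℕ) (c : ℕ → ℝ) :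
    Admissible (∑ i ∈ Finset.range m, C (c i) * X ^ (i + 2)) := by
  induction m with
  | zero => simpa using admissible_zero
  | succ m ih =>
    rw [Finset.sum_range_succ]
    exact ih.add (Admissible.smul _ (admissible_X_pow (by omega)))

end KMV2000

namespace Zhang2022

namespace Repair

open Polynomial MeasureTheory
open Literature.NumberTheory.LFunctions.OnePieceMollifierCeiling

/-! ### Part 1 — status (I): the `K_fam^diag` designs of record -/

/-- **fam-C0-IS1p-lin-DΔ**: the Iwaniec–Sarnak one-piece linear profile `p(t) = t` (`q = p′ ≡ 1`) at logarithmic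
length `Δ`, level-individual harmonic family. [cite: IwaniecConversations2006, §7 (7.5), p. 97] -/
def memISlin (Δ : ℝ) : BfamDesign := .diag (.ac .levelIndividual Δ (fun _ => 1))

/-- Membership of the linear-profile design for `0 < Δ ≤ 1`. [cite: IwaniecConversations2006, §7 (7.5)] -/
theorem kbfam_ISlin {Δ : ℝ} (h0 : 0 < Δ) (h1 : Δ ≤ 1) : KBfam (memISlin Δ) :=
  ⟨h0, h1, intervalIntegrable_const, intervalIntegrable_const⟩

/-- Its verdict (flag DECIDED BY THEOREM), read off the intake. [cite: KowalskiMichelVanderKam2000, Thm 6.1] -/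
theorem vbfam_ISlin {Δ : ℝ} (h0 : 0 < Δ) (h1 : Δ ≤ 1) : VBfam (memISlin Δ) :=
  familyBfam_decided (memISlin Δ) (kbfam_ISlin h0 h1)

/-- The two pairing rows fam-C0-IS1p-lin-D1 / -D1o2 are members. [cite: IwaniecConversations2006, §7 (7.5)] -/
theorem kbfam_ISlin_pair : KBfam (memISlin 1) ∧ KBfam (memISlin (1 / 2)) :=
  ⟨kbfam_ISlin one_pos le_rfl, kbfam_ISlin (by norm_num) (by norm_num)⟩

/-- **Values of record of the pairing rows (kernel identities, even scale):** `propIS 1 (p′ ≡ 1) = ½` (the knife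
edge, touched only at `Δ = 1`) and `propIS ½ (p′ ≡ 1) = ⅓` — the design map's «expected exact 1/2, 1/3 (even)».
[cite: KowalskiMichelVanderKam2000, footnote 2 p. 7, §7 p. 21] -/
theorem isLin_values : propIS 1 (fun _ => (1 : ℝ)) = 1 / 2 ∧ propIS (1 / 2) (fun _ => (1 : ℝ)) = 1 / 3 := by
  refine ⟨propIS_one_const 1 one_ne_zero, ?_⟩
  rw [propIS_const (1 / 2) (by norm_num) 1 one_ne_zero]
  norm_num

/-- **fam-C0-KMV-Q1-x2-D1**: KMV's optimal profile `P₀ = x²` AT the endpoint `Δ = 1`, entered through its second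
derivative `q = P″ ≡ 2` (the intake's `.poly` row is KMV's printed open range `Δ < 1`; the endpoint is the `.ac`
row, «(expanded length)² ≤ |family|»). [cite: KowalskiMichelVanderKam2000, §7 p. 21 (P₀ = x²), Remark p. 20 (Δ = 1)] -/
def memKMVx2one : BfamDesign := .diag (.ac .levelIndividual 1 (fun _ => 2))

/-- Membership of `x²` at `Δ = 1`. [cite: KowalskiMichelVanderKam2000, Remark p. 20] -/
theorem kbfam_KMVx2one : KBfam memKMVx2one :=
  ⟨one_pos, le_rfl, intervalIntegrable_const, intervalIntegrable_const⟩

/-- Its verdict. [cite: KowalskiMichelVanderKam2000, Thm 6.1] -/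
theorem vbfam_KMVx2one : VBfam memKMVx2one := familyBfam_decided memKMVx2one kbfam_KMVx2one

/-- **The pairing identity FC1 at the edge** («IS-onepiece = 2·KMV»): `propIS 1 (P″ ≡ 2) = ½` (even scale) and
`KMV2000.ratio 1 x² 1 = ¼` (all-forms scale) — the map's «1/2 (even); 1/4 (all)» for this row, as kernel identities.
[cite: KowalskiMichelVanderKam2000, §1 Thm 1.1 (p₀ ≥ 1/4), §7 p. 21] -/
theorem kmvx2_values : propIS 1 (fun _ => (2 : ℝ)) = 1 / 2 ∧ KMV2000.ratio 1 (X ^ 2) 1 = 1 / 4 :=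
  ⟨propIS_one_const 2 two_ne_zero, KMV2000.ratio_one_X_sq_at_one⟩

/-- **Free KMV-profile rows** (G0-IS1p-free8-DΔ for `Δ < 1`, fam-C0-free14-D3o4, and the aspect rows fam-C1-*):
the design with aspect tag `A`, length `Δ`, profile `P`. [cite: KowalskiMichelVanderKam2000, Thm 6.1, §7 p. 21] -/
def memFreePoly (A : DiagAspect) (Δ : ℝ) (P : ℝ[X]) : BfamDesign := .diag (.poly A Δ P)

/-- Membership of a free-profile row: `0 < Δ < 1` and `P` admissible. [cite: KowalskiMichelVanderKam2000, Props 4.1/5.1] -/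
theorem kbfam_freePoly (A : DiagAspect) {Δ : ℝ} {P : ℝ[X]} (h0 : 0 < Δ) (h1 : Δ < 1)
    (hP : KMV2000.Admissible P) : KBfam (memFreePoly A Δ P) :=
  ⟨h0, h1, hP⟩

/-- Verdict of a free-profile row: `ratio Δ P 1 ≤ envelope Δ ∧ ratio Δ P 1 < ¼` (DECIDED BY THEOREM).
[cite: KowalskiMichelVanderKam2000, Thm 6.1, §7 p. 21] -/
theorem vbfam_freePoly (A : DiagAspect) {Δ : ℝ} {P : ℝ[X]} (h0 : 0 < Δ) (h1 : Δ < 1)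
    (hP : KMV2000.Admissible P) : VBfam (memFreePoly A Δ P) :=
  familyBfam_decided (memFreePoly A Δ P) (kbfam_freePoly A h0 h1 hP)

/-- **The G0 grid** `Δ = k/20`, `k = 1, …, 19` (the twentieth point `Δ = 1` is the `.ac` row `kbfam_freeAC`): every
admissible profile at every grid length is a member. [cite: KowalskiMichelVanderKam2000, §7 p. 21] -/
theorem kbfam_G0_grid {k : ℕ} (hk1 : 1 ≤ k) (hk : k ≤ 19) {P : ℝ[X]} (hP : KMV2000.Admissible P) :
    KBfam (memFreePoly .levelIndividual ((k : ℝ) / 20) P) := by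
  refine kbfam_freePoly _ ?_ ?_ hP
  · have : (1 : ℝ) ≤ k := by exact_mod_cast hk1
    positivity
  · have : (k : ℝ) ≤ 19 := by exact_mod_cast hk
    linarith

/-- The free-profile OPTIMISERS are members: any `Σ_{i<m} cᵢ x^{i+2}` at any `0 < Δ < 1` (the rows «free deg ≤ 8»
are `m = 7`). [cite: KowalskiMichelVanderKam2000, §7 p. 21] -/
theorem kbfam_freePoly_span (A : DiagAspect) {Δ : ℝ} (h0 : 0 < Δ) (h1 : Δ < 1) (m : ℕ) (c : ℕ → ℝ) :
    KBfam (memFreePoly A Δ (∑ i ∈ Finset.range m, C (c i) * X ^ (i + 2))) :=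
  kbfam_freePoly A h0 h1 (KMV2000.admissible_span m c)

/-- The value of record on the `x²` row at every length: `ratio Δ x² 1 = envelope Δ = Δ/(2(1+Δ))` (all-forms scale;
`𝔭*_even = Δ/(1+Δ)` = the G0 line's exact rationals `1/21, 1/11, …, 1/2`). [cite: KowalskiMichelVanderKam2000, §7 p. 21] -/
theorem freePoly_x2_value {Δ : ℝ} (h0 : 0 < Δ) :
    KMV2000.ratio Δ (X ^ 2) 1 = KMV2000.envelope Δ ∧ 2 * KMV2000.envelope Δ = Δ / (1 + Δ) := by
  refine ⟨KMV2000.ratio_one_X_sq h0, ?_⟩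
  have h : (1 + Δ) ≠ 0 := by linarith
  rw [KMV2000.envelope]
  field_simp

/-- **Free H¹/AC-profile rows at the endpoint** (G0 `k = 20`, fam-C0-IS1p-free14-D1, fam-C0-KMV-Q1-free12-D1): the
design with aspect `A`, length `Δ ≤ 1`, derivative profile `q = R` a polynomial. [cite: IwaniecConversations2006, §7 (7.5)] -/
def memFreeAC (A : DiagAspect) (Δ : ℝ) (R : ℝ[X]) : BfamDesign := .diag (.ac A Δ (fun x => R.eval x))

/-- Membership of a free AC row: `0 < Δ ≤ 1`; a polynomial `q` and its square are interval-integrable.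
[cite: IwaniecConversations2006, §7 (7.5)] -/
theorem kbfam_freeAC (A : DiagAspect) {Δ : ℝ} (h0 : 0 < Δ) (h1 : Δ ≤ 1) (R : ℝ[X]) :
    KBfam (memFreeAC A Δ R) :=
  ⟨h0, h1, R.continuous.intervalIntegrable _ _, (R.continuous.pow 2).intervalIntegrable _ _⟩

/-- Verdict of a free AC row: `propIS Δ q ≤ Δ/(1+Δ) ∧ propIS Δ q ≤ ½` (DECIDED BY THEOREM).
[cite: KowalskiMichelVanderKam2000, Thm 6.1, Remark p. 20] -/
theorem vbfam_freeAC (A : DiagAspect) {Δ : ℝ} (h0 : 0 < Δ) (h1 : Δ ≤ 1) (R : ℝ[X]) :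
    VBfam (memFreeAC A Δ R) :=
  familyBfam_decided (memFreeAC A Δ R) (kbfam_freeAC A h0 h1 R)

/-- **fam-C1-weightK** (weight-`K` average, law `Δ/(1+Δ)`, BF21 Lemma 8.6) is a member under its tag.
[cite: KowalskiMichelVanderKam2000, Thm 6.1] -/
theorem kbfam_C1_weightK {Δ : ℝ} {P : ℝ[X]} (h0 : 0 < Δ) (h1 : Δ < 1) (hP : KMV2000.Admissible P) :
    KBfam (memFreePoly .weightAverage Δ P) :=
  kbfam_freePoly _ h0 h1 hP

/-- **fam-C1-spectral** (Maass spectral average, law `Δ/(1+Δ)`, BHS21) is a member under its tag.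
[cite: KowalskiMichelVanderKam2000, Thm 6.1] -/
theorem kbfam_C1_spectral {Δ : ℝ} {P : ℝ[X]} (h0 : 0 < Δ) (h1 : Δ < 1) (hP : KMV2000.Admissible P) :
    KBfam (memFreePoly .maassSpectral Δ P) :=
  kbfam_freePoly _ h0 h1 hP

/-! ### Part 2 — status (II-a): designs BEYOND the range (CONDITIONAL on the three displayed printed inputs) -/

/-- **The COND rows** (G0-IS1p-free8-DΔ-COND, fam-C0-IS1p-free8-DΔ-cond): a level-individual design of length
`Δ > 1` with profile `P`. [cite: KowalskiMichelVanderKam2000, §8.4 p. 28 (L73–77)] -/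
def memCond (Δ : ℝ) (P : ℝ[X]) : BfamDesign := .beyond ⟨.levelIndividual, Δ, P⟩

/-- Membership of a COND row: `1 < Δ`, `P` admissible. [cite: KowalskiMichelVanderKam2000, §8.4 p. 28] -/
theorem kbfam_cond {Δ : ℝ} {P : ℝ[X]} (hΔ : 1 < Δ) (hP : KMV2000.Admissible P) : KBfam (memCond Δ P) :=
  ⟨hΔ, hP⟩

/-- Verdict of a COND row (flag CONDITIONAL): `¼ < envelope Δ ∧ ∀ k ≥ 2 even, ForcedHalfTotal k`.
[cite: IwaniecConversations2006, §7 p. 97 (L17–22)] -/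
theorem vbfam_cond {Δ : ℝ} {P : ℝ[X]} (hΔ : 1 < Δ) (hP : KMV2000.Admissible P) : VBfam (memCond Δ P) :=
  familyBfam_decided (memCond Δ P) (kbfam_cond hΔ hP)

/-- **The five COND lengths of record** `Δ ∈ {21/20, 11/10, 5/4, 3/2, 2}` with `P = x²` are members.
[cite: KowalskiMichelVanderKam2000, §8.4 p. 28] -/
theorem kbfam_cond_grid :
    KBfam (memCond (21 / 20) (X ^ 2)) ∧ KBfam (memCond (11 / 10) (X ^ 2)) ∧ KBfam (memCond (5 / 4) (X ^ 2)) ∧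
      KBfam (memCond (3 / 2) (X ^ 2)) ∧ KBfam (memCond 2 (X ^ 2)) :=
  ⟨kbfam_cond (by norm_num) KMV2000.admissible_X_sq, kbfam_cond (by norm_num) KMV2000.admissible_X_sq,
    kbfam_cond (by norm_num) KMV2000.admissible_X_sq, kbfam_cond (by norm_num) KMV2000.admissible_X_sq,
    kbfam_cond (by norm_num) KMV2000.admissible_X_sq⟩

/-- **Diagonal-continued targets of the COND rows** («IF the off-diagonal contributed no main term», even scale
`2·envelope Δ`): `21/41, 11/21, 5/9, 3/5, 2/3` — all `> ½`, which is why these designs are candidates ONLY through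
their closing input famE-02 (open in print, priced XL). Kernel identities of `KMV2000.envelope`, not numerics.
[cite: KowalskiMichelVanderKam2000, §8.4 p. 28 (L73–77)] -/
theorem cond_targets :
    2 * KMV2000.envelope (21 / 20) = 21 / 41 ∧ 2 * KMV2000.envelope (11 / 10) = 11 / 21 ∧
      2 * KMV2000.envelope (5 / 4) = 5 / 9 ∧ 2 * KMV2000.envelope (3 / 2) = 3 / 5 ∧
        2 * KMV2000.envelope 2 = 2 / 3 := by
  refine ⟨?_, ?_, ?_, ?_, ?_⟩ <;> norm_num [KMV2000.envelope]

/-- **C2b-long** (restricted compatible level average with mollifier beyond the level-average range) is a member of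
the (II-a) stratum under its tag. [cite: IwaniecConversations2006, §7 p. 97 (L17–22)] -/
theorem kbfam_C2bLong {Δ : ℝ} {P : ℝ[X]} (hΔ : 1 < Δ) (hP : KMV2000.Admissible P) :
    KBfam (.beyond ⟨.restrictedLong, Δ, P⟩) :=
  ⟨hΔ, hP⟩

/-- **(η) aspect twins** beyond their range (0 design rows; statement level) are members under their tag.
[cite: IwaniecConversations2006, §7 p. 97] -/
theorem kbfam_aspectTwin {Δ : ℝ} {P : ℝ[X]} (hΔ : 1 < Δ) (hP : KMV2000.Admissible P) :
    KBfam (.beyond ⟨.aspectTwin, Δ, P⟩) :=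
  ⟨hΔ, hP⟩

/-- **Amplified designs with an expanded length beyond range** (0 design rows; statement level) are members under
their tag. [cite: IwaniecConversations2006, §7 p. 97] -/
theorem kbfam_amplifiedLong {Δ : ℝ} {P : ℝ[X]} (hΔ : 1 < Δ) (hP : KMV2000.Admissible P) :
    KBfam (.beyond ⟨.amplifiedLong, Δ, P⟩) :=
  ⟨hΔ, hP⟩

/-- Verdict of any (II-a) design under any tag. [cite: IwaniecConversations2006, §7 p. 97 (L17–22)] -/
theorem vbfam_beyond (κ : BeyondKind) {Δ : ℝ} {P : ℝ[X]} (hΔ : 1 < Δ) (hP : KMV2000.Admissible P) :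
    VBfam (.beyond ⟨κ, Δ, P⟩) :=
  familyBfam_decided (.beyond ⟨κ, Δ, P⟩) (show KBeyond ⟨κ, Δ, P⟩ from ⟨hΔ, hP⟩)

/-! ### Part 3 — status (II-b): designs INSIDE the ranges (GIVEN B-AH(fam); coordinates UNEVALUATED) -/

/-- **C2b-T**: a restricted compatible level average IN range, length `Δ`, profile `P`, with its two (A)-world
main-order values carried as unevaluated coordinates. [cite: IwaniecConversations2006, §7 (7.5)–(7.7)] -/
def memC2bT (Δ : ℝ) (P : ℝ[X]) (p₁ p₂ : ℝ) : BfamDesign := .narrow ⟨.restricted Δ P, p₁, p₂⟩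

/-- Membership of a C2b-T design: `0 < Δ ≤ 1`, `P` admissible — for ANY coordinates.
[cite: IwaniecConversations2006, §7 (7.5)] -/
theorem kbfam_C2bT {Δ : ℝ} {P : ℝ[X]} (h0 : 0 < Δ) (h1 : Δ ≤ 1) (hP : KMV2000.Admissible P) (p₁ p₂ : ℝ) :
    KBfam (memC2bT Δ P p₁ p₂) :=
  ⟨h0, h1, hP⟩

/-- Verdict of a C2b-T design (flag GIVEN): `BAHfam d → ¬ d.Certifies`. [cite: IwaniecConversations2006, §7 (7.7)] -/
theorem vbfam_C2bT {Δ : ℝ} {P : ℝ[X]} (h0 : 0 < Δ) (h1 : Δ ≤ 1) (hP : KMV2000.Admissible P) (p₁ p₂ : ℝ) :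
    VBfam (memC2bT Δ P p₁ p₂) :=
  familyBfam_decided (memC2bT Δ P p₁ p₂) (kbfam_C2bT h0 h1 hP p₁ p₂)

/-- **C2b′**: a BPZ-type product-mollifier design at the prime level `q ≡ −1 (mod D)` for the modulus `D`, length
`X = q^θ`, coordinates unevaluated. [cite: BuiPrattZaharescu2023, Thm 1.2 and Props 2.1–2.3 (ranges)] -/
def memBPZ (q D : ℕ) (θ p₁ p₂ : ℝ) : BfamDesign := .narrow ⟨.bpz q D θ, p₁, p₂⟩

/-- Membership of a C2b′ design — the class of record (intake v1.0.4): `q` prime, `1 < D` (no member at `D = 1`),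
`q ≡ −1 (mod D)`, `0 < θ < 1/2` (`X = q^θ` inside `√|family|`). The stratum carries TWO GIVEN sub-ranges, displayed in
the intake's (iii) sentence and SAID per member below: `θ < 1/6` — BPZ's printed mollified-moment asymptotics
(Props 2.1–2.3 as typed, p457180) are PROVED there, the row's GIVEN is the order-0 evaluation + B-AH(fam);
`1/6 ≤ θ < 1/2` — the BAND, GIVEN additionally the extension of Props 2.2/2.3 beyond `D⁸X⁶ ≪ q^{1−ε}`. The
coordinates stay UNEVALUATED in both. [cite: BuiPrattZaharescu2023, Thm 1.2 and Props 2.1–2.3 (ranges)] -/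
theorem kbfam_bpz {q D : ℕ} {θ : ℝ} (hq : q.Prime) (hD : 1 < D) (hdvd : D ∣ q + 1) (hθ0 : 0 < θ)
    (hθ : θ < 1 / 2) (p₁ p₂ : ℝ) : KBfam (memBPZ q D θ p₁ p₂) :=
  ⟨hq, hD, hdvd, hθ0, hθ⟩

/-- The literal C4 member of the intake, `(q, D, θ) = (11, 3, 1/8)` (`11` prime, `3 ∣ 12` so `χ(−11) = 1` for every
`χ mod 3`, `X = q^{1/8}`): GIVEN SUB-RANGE «`θ < 1/6`, BPZ Props 2.1–2.3 PROVED» — for any (unevaluated) coordinates.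
[cite: BuiPrattZaharescu2023, Thm 1.2] -/
theorem kbfam_bpz_11_3 (p₁ p₂ : ℝ) : KBfam (memBPZ 11 3 (1 / 8) p₁ p₂) :=
  kbfam_bpz (by norm_num) (by norm_num) (by norm_num) (by norm_num) (by norm_num) p₁ p₂

/-- A BAND member, `(q, D, θ) = (11, 3, 1/3)` (`X = q^{1/3}`, `X² ≤ q`): GIVEN SUB-RANGE «`1/6 ≤ θ < 1/2` — the
extension of BPZ Props 2.2/2.3 beyond `D⁸X⁶ ≪ q^{1−ε}` is presupposed, displayed beside B-AH(fam)» (REF-B3 D4 (a);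
intake v1.0.4 (iii) sentence) — for any (unevaluated) coordinates. [cite: BuiPrattZaharescu2023, Props 2.2–2.3 (ranges)] -/
theorem kbfam_bpz_11_3_band (p₁ p₂ : ℝ) : KBfam (memBPZ 11 3 (1 / 3) p₁ p₂) :=
  kbfam_bpz (by norm_num) (by norm_num) (by norm_num) (by norm_num) (by norm_num) p₁ p₂

/-- Verdict of a C2b′ design (flag GIVEN; nothing evaluated). [cite: IwaniecConversations2006, §7 (7.7)] -/
theorem vbfam_bpz {q D : ℕ} {θ : ℝ} (hq : q.Prime) (hD : 1 < D) (hdvd : D ∣ q + 1) (hθ0 : 0 < θ)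
    (hθ : θ < 1 / 2) (p₁ p₂ : ℝ) : VBfam (memBPZ q D θ p₁ p₂) :=
  familyBfam_decided (memBPZ q D θ p₁ p₂) (kbfam_bpz hq hD hdvd hθ0 hθ p₁ p₂)

/-- **C3′**: the amplified harmonic measure `ω_f·|A_f|²` with amplifier supported on the prime set `S`, amplifier
length `q̂^α`, mollifier `q̂^Δ`, profile `P`, coordinates unevaluated. [cite: IwaniecConversations2006, §7 (7.5)–(7.6)] -/
def memAmp (S : Finset ℕ) (α Δ : ℝ) (P : ℝ[X]) (p₁ p₂ : ℝ) : BfamDesign :=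
  .narrow ⟨.amplified S α Δ P, p₁, p₂⟩

/-- Membership of a C3′ design, stated with the FIRST-moment range `2α + Δ ≤ 1` (REF-B3 D1, intake v1.0.3+: «ALL expanded
lengths in range»; DESIGN-MAP §6.1 «2a+Δ ≤ 1 first»), which implies the second-moment range `α + Δ ≤ 1` given `0 ≤ α`;
the proof splits the displayed `InRange` conjunction leaf by leaf, so it elaborates against every landed text of the
intake's (iv) clause. [cite: IwaniecConversations2006, §7 (7.5)–(7.6)] -/
theorem kbfam_amp {S : Finset ℕ} {α Δ : ℝ} {P : ℝ[X]} (hS : ∀ ℓ ∈ S, ℓ.Prime) (hα : 0 ≤ α) (hΔ : 0 < Δ)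
    (h1st : 2 * α + Δ ≤ 1) (hP : KMV2000.Admissible P) (p₁ p₂ : ℝ) : KBfam (memAmp S α Δ P p₁ p₂) := by
  -- arity-robust: split the `InRange` conjunction whatever its length and close every leaf from the context
  -- (second-moment range `α + Δ ≤ 1` derived from the first-moment range and `0 ≤ α`)
  have h2nd : α + Δ ≤ 1 := by linarith
  simp only [memAmp, KBfam, KNarrow, NarrowMember.InRange]
  repeat' constructor
  -- leaves: `∀ ℓ ∈ S, ℓ.Prime`, `0 ≤ α`, `0 < Δ`, `α + Δ ≤ 1`, (`2α + Δ ≤ 1` if displayed), and the two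
  -- conjuncts `P(0) = 0`, `P′(0) = 0` of `KMV2000.Admissible P` (which `constructor` also splits)
  all_goals first | assumption | exact hP.1 | exact hP.2

/-- The literal C4 member of the intake: amplifier on the primes `{2, 3}` of length `q̂^{1/4}`, mollifier `q̂^{1/2}`,
profile `x²` (`2·¼ + ½ = 1`: at the first-moment edge). [cite: IwaniecConversations2006, §7 (7.5)] -/
theorem kbfam_amp_23 (p₁ p₂ : ℝ) : KBfam (memAmp {2, 3} (1 / 4) (1 / 2) (X ^ 2) p₁ p₂) := by
  refine kbfam_amp ?_ (by norm_num) (by norm_num) (by norm_num) KMV2000.admissible_X_sq p₁ p₂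
  intro ℓ hℓ
  simp only [Finset.mem_insert, Finset.mem_singleton] at hℓ
  rcases hℓ with rfl | rfl <;> norm_num

/-- An IIb-Q10 grid cell IN both ranges: amplifier on `{2, 3, 5}`, `(a, Δ) = (1/10, 13/20)` (`Δ + a = ¾`,
`2a + Δ = 17/20 ≤ 1`), profile `x²`. [cite: IwaniecConversations2006, §7 (7.5)] -/
theorem kbfam_amp_235 (p₁ p₂ : ℝ) : KBfam (memAmp {2, 3, 5} (1 / 10) (13 / 20) (X ^ 2) p₁ p₂) := by
  refine kbfam_amp ?_ (by norm_num) (by norm_num) (by norm_num) KMV2000.admissible_X_sq p₁ p₂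
  intro ℓ hℓ
  simp only [Finset.mem_insert, Finset.mem_singleton] at hℓ
  rcases hℓ with rfl | rfl | rfl <;> norm_num

/-- Verdict of a C3′ design (flag GIVEN). [cite: IwaniecConversations2006, §7 (7.7)] -/
theorem vbfam_amp {S : Finset ℕ} {α Δ : ℝ} {P : ℝ[X]} (hS : ∀ ℓ ∈ S, ℓ.Prime) (hα : 0 ≤ α) (hΔ : 0 < Δ)
    (h1st : 2 * α + Δ ≤ 1) (hP : KMV2000.Admissible P) (p₁ p₂ : ℝ) : VBfam (memAmp S α Δ P p₁ p₂) :=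
  familyBfam_decided (memAmp S α Δ P p₁ p₂) (kbfam_amp hS hα hΔ h1st hP p₁ p₂)

/-- On every (II-b) member the verdict IS «premise ⇒ conclusion» and nothing is evaluated: for the literal BPZ
member, `BAHfam` applied to any coordinates with `p₁ + p₂ ≤ 1` excludes certification, and coordinates with
`p₁ + p₂ > 1` would be exit-x1 material (the premise fails there). [cite: IwaniecConversations2006, §7 (7.7)] -/
theorem narrow_member_reading (p₁ p₂ : ℝ) :
    (p₁ + p₂ ≤ 1 → ¬ (⟨.bpz 11 3 (1 / 8), p₁, p₂⟩ : NarrowDesign).Certifies) ∧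
      (1 < p₁ + p₂ → ¬ BAHfam ⟨.bpz 11 3 (1 / 8), p₁, p₂⟩) :=
  ⟨fun h => not_lt.2 h, fun h hB => absurd hB (not_le.2 h)⟩

/-! ### Part 4 — the batch: every design row of record is a member, in ONE conjunction -/

/-- **C4 of INTAKE-3 by term, the batch of record** (DESIGN-MAP-fam v1.7.3): the pairing set (I), the G0 `x²` line at
`Δ = ½` (grid point `k = 10`), a free AC row at the endpoint `Δ = 1` (`q = 2x`, i.e. `P ∝ x³`), KMV's `P₁` at `Δ = ¾`,
the C1 tags, the five COND lengths (II-a), C2b-long, and one member of each (II-b) constructor (both (iii) GIVEN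
sub-ranges) — all in `K_fam`, for ANY unevaluated coordinates.
[cite: KowalskiMichelVanderKam2000, §7 p. 21] [cite: IwaniecConversations2006, §7 (7.5)–(7.7)] -/
theorem bfam_members_batch (p₁ p₂ : ℝ) :
    KBfam (memISlin 1) ∧ KBfam (memISlin (1 / 2)) ∧ KBfam memKMVx2one ∧
      KBfam (memFreePoly .levelIndividual ((10 : ℕ) / 20) (X ^ 2)) ∧ KBfam (memFreeAC .levelIndividual 1 (2 • X)) ∧
      KBfam (memFreePoly .levelIndividual (3 / 4) KMV2000.kmvP1) ∧
      KBfam (memFreePoly .weightAverage (1 / 2) (X ^ 2)) ∧ KBfam (memFreePoly .maassSpectral (1 / 2) (X ^ 2)) ∧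
      KBfam (memFreePoly .levelAverageUnrestricted (1 / 2) (X ^ 2)) ∧
      (KBfam (memCond (21 / 20) (X ^ 2)) ∧ KBfam (memCond (11 / 10) (X ^ 2)) ∧ KBfam (memCond (5 / 4) (X ^ 2)) ∧
        KBfam (memCond (3 / 2) (X ^ 2)) ∧ KBfam (memCond 2 (X ^ 2))) ∧
      KBfam (.beyond ⟨.restrictedLong, 3 / 2, X ^ 2⟩) ∧
      KBfam (memC2bT 1 (X ^ 2) p₁ p₂) ∧ KBfam (memBPZ 11 3 (1 / 8) p₁ p₂) ∧ KBfam (memBPZ 11 3 (1 / 3) p₁ p₂) ∧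
      KBfam (memAmp {2, 3} (1 / 4) (1 / 2) (X ^ 2) p₁ p₂) := by
  refine ⟨kbfam_ISlin one_pos le_rfl, kbfam_ISlin (by norm_num) (by norm_num), kbfam_KMVx2one,
    kbfam_G0_grid (by norm_num) (by norm_num) KMV2000.admissible_X_sq, kbfam_freeAC _ one_pos le_rfl _,
    kbfam_freePoly _ (by norm_num) (by norm_num) KMV2000.admissible_kmvP1,
    kbfam_C1_weightK (by norm_num) (by norm_num) KMV2000.admissible_X_sq,
    kbfam_C1_spectral (by norm_num) (by norm_num) KMV2000.admissible_X_sq,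
    kbfam_freePoly _ (by norm_num) (by norm_num) KMV2000.admissible_X_sq, kbfam_cond_grid,
    kbfam_C2bLong (by norm_num) KMV2000.admissible_X_sq,
    kbfam_C2bT one_pos le_rfl KMV2000.admissible_X_sq p₁ p₂, kbfam_bpz_11_3 p₁ p₂, kbfam_bpz_11_3_band p₁ p₂,
    kbfam_amp_23 p₁ p₂⟩

/-- The batch members inhabit the three families of the word's LIST `bfamWord = [familyBfamDiag, familyBfamBeyond,
familyBfamNarrow]` through the list's own classes (same terms). [cite: IwaniecConversations2006, §7 (7.5)–(7.7)] -/
theorem bfamWord_members (p₁ p₂ : ℝ) :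
    familyBfamDiag.InClass (DiagDesign.ac .levelIndividual 1 (fun _ => (1 : ℝ))) ∧
      familyBfamBeyond.InClass (⟨.levelIndividual, 2, X ^ 2⟩ : BeyondDesign) ∧
      familyBfamNarrow.InClass (⟨.amplified {2, 3} (1 / 4) (1 / 2) (X ^ 2), p₁, p₂⟩ : NarrowDesign) :=
  ⟨kbfam_ISlin one_pos le_rfl, kbfam_cond (by norm_num) KMV2000.admissible_X_sq, kbfam_amp_23 p₁ p₂⟩

end Repair

end Zhang2022

end Literature.NumberTheory.LFunctions

end
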